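import Summits.CriticalPhenomena.PercolationContinuityZ3.Theorems.PercNearOneGluingNoHeavyLowerTailTwoPortPeelingTools
import Summits.CriticalPhenomena.PercolationContinuityZ3.Theorems.PercNearOneGluingNoHeavyLowerTailTwoPortPeelingRelayOrder
import Summits.CriticalPhenomena.PercolationContinuityZ3.Theorems.PercNearOneGluingNoHeavyLowerTailTwoPortPeelingRealisation
import Summits.CriticalPhenomena.PercolationContinuityZ3.Theorems.PercNearOneGluingNoHeavyLowerTailTwoPortPeelingSurePairs
import HarnessLib

/-!
# `NoHeavyLowerTail` (stmt-CriticalPhenomena-4575) — MS-STAR for two two-port stars: the E_rel slice (memo TWO-PORT-PEELING.md §5)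

Route `PercNearOneGluingNoHeavy`, seat `prim-gen-swap` (gen 5).  For two new two-port star vertices `u` (ports `a ≠ a'`) and `v` (ports `b ≠ b'`),
all four ports distinct, and a champion `c ∉ {a,a',b,b'}`: CS₂(u,v;c) — `c` is a valid cumulative-isolation witness for the merged star — follows
from ONE explicit inequality E∅∅ (the "both stars comonotone" merge stability, certified by exact computation at (|A|,j) ∈
{(5,2),(6,2),(6,3),(7,2),(8,2)}, kit j054427), in the range `j ≤ 2 ∨ |A| ≤ j+3`.  This file: `TwoPortPeeling.erel_slice_nonneg` — the combination `(1−θ_u)h_a + θ_u h_{aa'}` of `u`-slices is E_rel(G₁;a) ≥ 0, via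
the realisation identities (`glue_pair_identity`, `glued_real_count_eq`, `pendant_real_relay_eq`, redundant sure pairs) and
`thetaChampion_virtualRelay_of_ae_reachable`.  The assembly is `…TwoPortPeelingTwoStars.lean`.  No definitions, no named facts, no sorries.
-/

noncomputable section

namespace Summit.CriticalPhenomena.PercolationContinuityZ3.Theorems

open MeasureTheory Set Literature.Probability.LatticeModels Literature.Probability.Percolation
open scoped Classical BigOperators

variable {n : ℕ}

namespace TwoPortPeeling

/-- **The E_rel slice combination is nonnegative (memo §5, (L2)+(P1)).**  Setting: `u, v ∉ A` two-port stars with ports `{a,a'}`,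
`{b,b'}` (all distinct), `c ∉ {a,a',b,b'}` a champion of `w`, `θ_u = w s(u,a)·w s(u,a')`, `θ_v = w s(v,b)·w s(v,b')`, range
`j ≤ 2 ∨ |A| ≤ j+3`.  With the `v`-pinned weights `w₀₀ = w[vb↦0][vb'↦0]`, `w₁₁ = w[vb↦1][vb'↦1]` of the two-port reduction and the `u`-slices
`h_S = (1−θ_v)(μ_{w₀₀,S}(R_c) − μ_{w₀₀,S}(L_u)) + θ_v Ψ_{w₁₁,S}` (`S` = which ports of `u` are pinned open), one has
`(1 − θ_u)·h_{a} + θ_u·h_{aa'} ≥ 0`: this combination equals E_rel(`G₁; a`) of the memo (realisation identities of this file's imports),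
whose hypothesis is the champion row of `c` against `a` (`relay_law_eq`) and which holds by `thetaChampion_virtualRelay_of_ae_reachable`.
[cite: VandenbergHaggstromKahn2005, Thm. 1.5 (p. 7) — only through the imported reduction; this step is bookkeeping] -/
theorem erel_slice_nonneg (w : Sym2 (Fin n) → unitInterval) (A : Finset (Fin n))
    (u v a a' b b' c : Fin n) (j : ℕ) (hu : u ∉ A) (hv : v ∉ A) (huv : u ≠ v)
    (ha : a ∈ A) (ha' : a' ∈ A) (hb : b ∈ A) (hb' : b' ∈ A) (hc : c ∈ A)
    (haa' : a ≠ a') (hbb' : b ≠ b') (hab : a ≠ b) (hab' : a ≠ b') (ha'b : a' ≠ b)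
    (hcb : c ≠ b) (hcb' : c ≠ b')
    (hutwo : ∀ y : Fin n, y ≠ u → y ≠ a → y ≠ a' → w s(u, y) = 0)
    (hvtwo : ∀ y : Fin n, y ≠ v → y ≠ b → y ≠ b' → w s(v, y) = 0)
    (hreg : j ≤ 2 ∨ A.card ≤ j + 3)
    (hchamp : ∀ x ∈ A,
      (prodBernoulli w).real {ω : BondConfig (Fin n) | (A.filter fun z => ω ∈ openConn x z).card ≤ j} ≤
        (prodBernoulli w).real {ω : BondConfig (Fin n) | (A.filter fun z => ω ∈ openConn c z).card ≤ j}) :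
    0 ≤ (1 - ((w s(u, a) : ℝ) * w s(u, a'))) * ((1 - ((w s(v, b) : ℝ) * w s(v, b'))) * ((prodBernoulli (Function.update (Function.update (Function.update (Function.update w s(v, b) 0) s(v, b') 0) s(u, a) 1) s(u, a') 0)).real {ω : BondConfig (Fin n) | (A.filter fun z => ω ∈ openConn c z).card ≤ j} - (prodBernoulli (Function.update (Function.update (Function.update (Function.update w s(v, b) 0) s(v, b') 0) s(u, a) 1) s(u, a') 0)).real {ω : BondConfig (Fin n) | 1 ≤ (A.filter fun z => ω ∈ openConn u z).card ∧ (A.filter fun z => ω ∈ openConn u z).card ≤ j}) + ((w s(v, b) : ℝ) * w s(v, b')) * ((prodBernoulli (Function.update (Function.update (Function.update (Function.update w s(v, b) 1) s(v, b') 1) s(u, a) 1) s(u, a') 0)).real {ω : BondConfig (Fin n) | ω ∉ openConn c u ∧ ω ∉ openConn c v ∧ (A.filter fun z => ω ∈ openConn c z).card ≤ j} - (prodBernoulli (Function.update (Function.update (Function.update (Function.update w s(v, b) 1) s(v, b') 1) s(u, a) 1) s(u, a') 0)).real {ω : BondConfig (Fin n) | ω ∉ openConn c u ∧ ω ∉ openConn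 c v ∧ 1 ≤ (A.filter fun z => ω ∈ openConn u z ∨ ω ∈ openConn v z).card ∧ (A.filter fun z => ω ∈ openConn u z ∨ ω ∈ openConn v z).card ≤ j})) +
      ((w s(u, a) : ℝ) * w s(u, a')) * ((1 - ((w s(v, b) : ℝ) * w s(v, b'))) * ((prodBernoulli (Function.update (Function.update (Function.update (Function.update w s(v, b) 0) s(v, b') 0) s(u, a) 1) s(u, a') 1)).real {ω : BondConfig (Fin n) | (A.filter fun z => ω ∈ openConn c z).card ≤ j} - (prodBernoulli (Function.update (Function.update (Function.update (Function.update w s(v, b) 0) s(v, b') 0) s(u, a) 1) s(u, a') 1)).real {ω : BondConfig (Fin n) | 1 ≤ (A.filter fun z => ω ∈ openConn u z).card ∧ (A.filter fun z => ω ∈ openConn u z).card ≤ j}) + ((w s(v, b) : ℝ) * w s(v, b')) * ((prodBernoulli (Function.update (Function.update (Function.update (Function.update w s(v, b) 1) s(v, b') 1) s(u, a) 1) s(u, a') 1)).real {ω : BondConfig (Fin n) | ω ∉ openConn c u ∧ ω ∉ openConn c v ∧ (A.filter fun z => ω ∈ openConn c z).card ≤ j} - (prodBernoulli (Function.update (Function.update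 (Function.update (Function.update w s(v, b) 1) s(v, b') 1) s(u, a) 1) s(u, a') 1)).real {ω : BondConfig (Fin n) | ω ∉ openConn c u ∧ ω ∉ openConn c v ∧ 1 ≤ (A.filter fun z => ω ∈ openConn u z ∨ ω ∈ openConn v z).card ∧ (A.filter fun z => ω ∈ openConn u z ∨ ω ∈ openConn v z).card ≤ j})) := by
  -- vertex inequalities
  have hua : u ≠ a := fun h => hu (h ▸ ha)
  have hua' : u ≠ a' := fun h => hu (h ▸ ha')
  have hub : u ≠ b := fun h => hu (h ▸ hb)
  have hub' : u ≠ b' := fun h => hu (h ▸ hb')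
  have huc : u ≠ c := fun h => hu (h ▸ hc)
  have hva : v ≠ a := fun h => hv (h ▸ ha)
  have hva' : v ≠ a' := fun h => hv (h ▸ ha')
  have hvb : v ≠ b := fun h => hv (h ▸ hb)
  have hvb' : v ≠ b' := fun h => hv (h ▸ hb')
  have hvc : v ≠ c := fun h => hv (h ▸ hc)
  -- pair inequalities `s(p,q) ≠ s(r,t)`
  have png : ∀ {p q r t : Fin n}, (p ≠ r ∨ q ≠ t) → (p ≠ t ∨ q ≠ r) → (s(p, q) : Sym2 (Fin n)) ≠ s(r, t) := by
    intro p q r t h1 h2 h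
    rw [Sym2.eq_iff] at h
    rcases h with ⟨h3, h4⟩ | ⟨h3, h4⟩
    · rcases h1 with h1 | h1
      · exact h1 h3
      · exact h1 h4
    · rcases h2 with h2 | h2
      · exact h2 h3
      · exact h2 h4
  have n_ua_ua' : (s(u, a) : Sym2 (Fin n)) ≠ s(u, a') := png (Or.inr haa') (Or.inl hua')
  have n_ua_vb : (s(u, a) : Sym2 (Fin n)) ≠ s(v, b) := png (Or.inl huv) (Or.inl hub)
  have n_ua_vb' : (s(u, a) : Sym2 (Fin n)) ≠ s(v, b') := png (Or.inl huv) (Or.inl hub')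
  have n_ua'_vb : (s(u, a') : Sym2 (Fin n)) ≠ s(v, b) := png (Or.inl huv) (Or.inl hub)
  have n_ua'_vb' : (s(u, a') : Sym2 (Fin n)) ≠ s(v, b') := png (Or.inl huv) (Or.inl hub')
  have n_vb_vb' : (s(v, b) : Sym2 (Fin n)) ≠ s(v, b') := png (Or.inr hbb') (Or.inl hvb')
  have n_uv_ua : (s(u, v) : Sym2 (Fin n)) ≠ s(u, a) := png (Or.inr hva) (Or.inl hua)
  have n_uv_ua' : (s(u, v) : Sym2 (Fin n)) ≠ s(u, a') := png (Or.inr hva') (Or.inl hua')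
  have n_uv_vb : (s(u, v) : Sym2 (Fin n)) ≠ s(v, b) := png (Or.inl huv) (Or.inl hub)
  have n_uv_vb' : (s(u, v) : Sym2 (Fin n)) ≠ s(v, b') := png (Or.inl huv) (Or.inl hub')
  have n_ab_ua : (s(a, b) : Sym2 (Fin n)) ≠ s(u, a) := png (Or.inl hua.symm) (Or.inr hub.symm)
  have n_ab_ua' : (s(a, b) : Sym2 (Fin n)) ≠ s(u, a') := png (Or.inl hua.symm) (Or.inl haa')
  have n_ab_vb : (s(a, b) : Sym2 (Fin n)) ≠ s(v, b) := png (Or.inl hva.symm) (Or.inl hab)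
  have n_ab_vb' : (s(a, b) : Sym2 (Fin n)) ≠ s(v, b') := png (Or.inl hva.symm) (Or.inl hab')
  have n_ab_uv : (s(a, b) : Sym2 (Fin n)) ≠ s(u, v) := png (Or.inl hua.symm) (Or.inl hva.symm)
  have n_au_ab : (s(a, u) : Sym2 (Fin n)) ≠ s(a, b) := png (Or.inr hub) (Or.inl hab)
  have n_au_uv : (s(a, u) : Sym2 (Fin n)) ≠ s(u, v) := png (Or.inl hua.symm) (Or.inl hva.symm)
  have n_bv_uv : (s(b, v) : Sym2 (Fin n)) ≠ s(u, v) := png (Or.inl hub.symm) (Or.inl hvb.symm)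
  have n_bv_ab : (s(b, v) : Sym2 (Fin n)) ≠ s(a, b) := png (Or.inl hab.symm) (Or.inr hva)
  have n_bv_ua : (s(b, v) : Sym2 (Fin n)) ≠ s(u, a) := png (Or.inl hub.symm) (Or.inr huv.symm)
  -- weights
  set V0 := Function.update (Function.update w s(v, b) 0) s(v, b') 0 with hV0
  set V1 := Function.update (Function.update w s(v, b) 1) s(v, b') 1 with hV1
  set V0_10 := Function.update (Function.update V0 s(u, a) 1) s(u, a') 0 with hV0_10
  set V0_11 := Function.update (Function.update V0 s(u, a) 1) s(u, a') 1 with hV0_11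
  set V1_10 := Function.update (Function.update V1 s(u, a) 1) s(u, a') 0 with hV1_10
  set V1_11 := Function.update (Function.update V1 s(u, a) 1) s(u, a') 1 with hV1_11
  set V0_00 := Function.update (Function.update V0 s(u, a) 0) s(u, a') 0 with hV0_00
  set Wp := Function.update V1 s(a, b) 1 with hWp
  set Wp_00 := Function.update (Function.update Wp s(u, a) 0) s(u, a') 0 with hWp_00
  set Wp_10 := Function.update (Function.update Wp s(u, a) 1) s(u, a') 0 with hWp_10
  set Wp_11 := Function.update (Function.update Wp s(u, a) 1) s(u, a') 1 with hWp_11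
  set θu : ℝ := (w s(u, a) : ℝ) * w s(u, a') with hθu
  set θv : ℝ := (w s(v, b) : ℝ) * w s(v, b') with hθv
  -- relay loneliness as a function of the weights
  set R : (Sym2 (Fin n) → unitInterval) → Fin n → ℝ := fun W x =>
    (prodBernoulli W).real {ω : BondConfig (Fin n) | (A.filter fun z => ω ∈ openConn x z).card ≤ j} with hR
  have hθv0 : 0 ≤ θv := mul_nonneg (w s(v, b)).2.1 (w s(v, b')).2.1
  -- basic evaluations of the pinned weights
  have hV1vb : V1 s(v, b) = 1 := by rw [hV1, Function.update_of_ne n_vb_vb', Function.update_self]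
  have hV1vb' : V1 s(v, b') = 1 := by rw [hV1, Function.update_self]
  have hutwo0 : ∀ y : Fin n, y ≠ u → y ≠ a → y ≠ a' → V0 s(u, y) = 0 := by
    intro y hyu hya hya'
    rw [hV0, Function.update_of_ne (png (Or.inl huv) (Or.inl hub')), Function.update_of_ne (png (Or.inl huv) (Or.inl hub))]
    exact hutwo y hyu hya hya'
  have hutwo1 : ∀ y : Fin n, y ≠ u → y ≠ a → y ≠ a' → V1 s(u, y) = 0 := by
    intro y hyu hya hya'
    rw [hV1, Function.update_of_ne (png (Or.inl huv) (Or.inl hub')), Function.update_of_ne (png (Or.inl huv) (Or.inl hub))]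
    exact hutwo y hyu hya hya'
  have hutwop : ∀ y : Fin n, y ≠ u → y ≠ a → y ≠ a' → Wp s(u, y) = 0 := by
    intro y hyu hya hya'
    rw [hWp, Function.update_of_ne (png (Or.inl hua) (Or.inl hub))]
    exact hutwo1 y hyu hya hya'
  have hθu0 : ((V0 s(u, a) : ℝ) * V0 s(u, a')) = θu := by
    rw [hV0, Function.update_of_ne n_ua'_vb', Function.update_of_ne n_ua'_vb, Function.update_of_ne n_ua_vb',
      Function.update_of_ne n_ua_vb]
  have hθup : ((Wp s(u, a) : ℝ) * Wp s(u, a')) = θu := by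
    rw [hWp, Function.update_of_ne n_ab_ua'.symm, Function.update_of_ne n_ab_ua.symm, hV1,
      Function.update_of_ne n_ua'_vb', Function.update_of_ne n_ua'_vb, Function.update_of_ne n_ua_vb',
      Function.update_of_ne n_ua_vb]
  -- (K) the champion row of `c` against `a`, split over `v`'s ports
  have hK : 0 ≤ (1 - θv) * (R V0 c - R V0 a) + θv * (R V1 c - R V1 a) := by
    have h1 := relay_law_eq w A c j hv hbb' hvb.symm hvb'.symm hvc.symm hvtwo
    have h2 := relay_law_eq w A a j hv hbb' hvb.symm hvb'.symm hva.symm hvtwo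
    have h3 := hchamp a ha
    change R w a ≤ R w c at h3
    change R w c = (1 - θv) * R V0 c + θv * R V1 c at h1
    change R w a = (1 - θv) * R V0 a + θv * R V1 a at h2
    rw [h1, h2] at h3
    linarith
  -- (N) `b ↔ b'` almost surely under `V1[ab↦0]` (through `v`)
  have hnull : (prodBernoulli (Function.update V1 s(a, b) 0)).real
      {ω : BondConfig (Fin n) | ω ∉ openConn b b'} = 0 := by
    refine real_not_reachable_eq_zero_of_sure_path2 _ b v b' hvb.symm hvb' ?_ ?_
    · rw [show (s(b, v) : Sym2 (Fin n)) = s(v, b) from Sym2.eq_swap, Function.update_of_ne n_ab_vb.symm]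
      exact hV1vb
    · rw [Function.update_of_ne n_ab_vb'.symm]
      exact hV1vb'
  -- (E) E_rel for `a`
  have hE := thetaChampion_virtualRelay_of_ae_reachable V1 A a b b' c j θv (R V0 c - R V0 a) hθv0
    hb hb' hc hab hbb' hcb hcb' hreg hnull hK
  change 0 ≤ (1 - θv) * (R V0 c - R V0 a) + θv * (R Wp c - R Wp a) at hE
  -- split the four relay terms of (E) over `u`'s two ports
  have hsplit0 : ∀ x : Fin n, x ≠ u → R V0 x = (1 - θu) * R V0_00 x + θu * R V0_11 x := by
    intro x hxu
    have h := relay_law_eq V0 A x j hu haa' hua.symm hua'.symm hxu hutwo0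
    rw [hθu0] at h
    exact h
  have hsplitp : ∀ x : Fin n, x ≠ u → R Wp x = (1 - θu) * R Wp_00 x + θu * R Wp_11 x := by
    intro x hxu
    have h := relay_law_eq Wp A x j hu haa' hua.symm hua'.symm hxu hutwop
    rw [hθup] at h
    exact h
  rw [hsplit0 c huc.symm, hsplit0 a hua.symm, hsplitp c huc.symm, hsplitp a hua.symm] at hE
  -- (i)/(ii): the slice "u glued to a, v deleted"
  have h00u : ∀ y : Fin n, y ≠ u → V0_00 s(u, y) = 0 := deleted_zero_at V0 haa' hua.symm hutwo0
  have hV0_10' : V0_10 = Function.update V0_00 s(u, a) 1 := update_one_zero_eq V0 n_ua_ua'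
  have e1 : R V0_10 c = R V0_00 c := by
    show (prodBernoulli V0_10).real _ = (prodBernoulli V0_00).real _
    rw [hV0_10']
    exact pendant_real_relay_eq V0_00 A u a c j hu hua.symm huc.symm h00u
  have e2 : (prodBernoulli V0_10).real {ω : BondConfig (Fin n) |
      1 ≤ (A.filter fun z => ω ∈ openConn u z).card ∧ (A.filter fun z => ω ∈ openConn u z).card ≤ j} = R V0_00 a := by
    rw [hV0_10']
    have g := glued_real_count_eq V0_00 A u a (fun m => 1 ≤ m ∧ m ≤ j) hua.symm (h00u a hua.symm)
    rw [← relay_lonely_eq_small A a j ha] at g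
    rw [g]
    exact pendant_real_relay_eq V0_00 A u a a j hu hua.symm hua.symm h00u
  -- (iii): the slice "u glued to a and a', v deleted"
  have e3 : (prodBernoulli V0_11).real {ω : BondConfig (Fin n) |
      1 ≤ (A.filter fun z => ω ∈ openConn u z).card ∧ (A.filter fun z => ω ∈ openConn u z).card ≤ j} = R V0_11 a := by
    have hB : Function.update (Function.update V0 s(u, a) 0) s(u, a') 1 s(u, a) = 0 := by
      rw [Function.update_of_ne n_ua_ua', Function.update_self]
    have hV0_11' : V0_11 = Function.update (Function.update (Function.update V0 s(u, a) 0) s(u, a') 1) s(u, a) 1 :=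
      update_one_one_eq V0 n_ua_ua'
    have g := glued_real_count_eq _ A u a (fun m => 1 ≤ m ∧ m ≤ j) hua.symm hB
    rw [← relay_lonely_eq_small A a j ha] at g
    rw [hV0_11']
    exact g
  -- a redundant sure pair does not change relay counts (both directions packaged)
  have hred : ∀ (W : Sym2 (Fin n) → unitInterval) (x y z : Fin n), x ≠ y →
      (prodBernoulli (Function.update W s(x, y) 0)).real {ω : BondConfig (Fin n) | ω ∉ openConn x y} = 0 →
      R W z = R (Function.update W s(x, y) 1) z := by
    intro W x y z hxy hn
    have h1 := real_count_update_one_eq_of_ae_reachable W A z (fun m => m ≤ j) hxy hn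
    have h2 := stub_oneBondDecomp_k15 n W s(x, y)
      {ω : BondConfig (Fin n) | (A.filter fun t => ω ∈ openConn z t).card ≤ j}
    change R W z = (1 - (W s(x, y) : ℝ)) * R (Function.update W s(x, y) 0) z +
      (W s(x, y) : ℝ) * R (Function.update W s(x, y) 1) z at h2
    change R (Function.update W s(x, y) 1) z = R (Function.update W s(x, y) 0) z at h1
    rw [h2, h1]; ring
  -- (iv): the slice "u glued to a, v glued to b,b'": Ψ = R Wp_00 c − R Wp_00 a
  have hV1_10uv : V1_10 s(u, v) = 0 := by
    rw [hV1_10, Function.update_of_ne n_uv_ua', Function.update_of_ne n_uv_ua]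
    exact hutwo1 v huv.symm hva hva'
  have g4 := glue_pair_identity V1_10 A u v c j huv.symm hc hV1_10uv
  set Wg := Function.update V1_10 s(u, v) 1 with hWg
  have hWg' : Wg = Function.update (Function.update (Function.update (Function.update V1 s(u, a) 0) s(u, a') 0)
      s(u, v) 1) s(u, a) 1 := by
    rw [hWg, hV1_10]
    funext e
    by_cases h1 : e = s(u, a)
    · subst h1; simp [n_uv_ua.symm, n_ua_ua']
    · by_cases h2 : e = s(u, a')
      · subst h2; simp [n_uv_ua'.symm, n_ua_ua'.symm]
      · by_cases h3 : e = s(u, v)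
        · subst h3; simp [n_uv_ua]
        · simp [h1, h2, h3]
  have e4L : (prodBernoulli Wg).real {ω : BondConfig (Fin n) |
      1 ≤ (A.filter fun z => ω ∈ openConn u z).card ∧ (A.filter fun z => ω ∈ openConn u z).card ≤ j} = R Wg a := by
    have hB : Function.update (Function.update (Function.update V1 s(u, a) 0) s(u, a') 0) s(u, v) 1 s(u, a) = 0 := by
      rw [Function.update_of_ne n_uv_ua.symm, Function.update_of_ne n_ua_ua', Function.update_self]
    have g := glued_real_count_eq _ A u a (fun m => 1 ≤ m ∧ m ≤ j) hua.symm hB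
    rw [← relay_lonely_eq_small A a j ha, ← hWg'] at g
    exact g
  -- `a ↔ b` a.s. under `Wg[ab↦0]` (path a–u–v–b), so the pair `s(a,b)` is redundant in `Wg`
  have hWg_ab : ∀ z : Fin n, R Wg z = R (Function.update Wg s(a, b) 1) z := by
    intro z
    refine hred Wg a b z hab ?_
    refine real_not_reachable_eq_zero_of_sure_path3 _ a u v b hua.symm huv hvb ?_ ?_ ?_
    · rw [Function.update_of_ne n_au_ab, hWg, Function.update_of_ne n_au_uv, hV1_10,
        show (s(a, u) : Sym2 (Fin n)) = s(u, a) from Sym2.eq_swap, Function.update_of_ne n_ua_ua',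
        Function.update_self]
    · rw [Function.update_of_ne n_ab_uv.symm, hWg, Function.update_self]
    · rw [Function.update_of_ne n_ab_vb.symm, hWg, Function.update_of_ne n_uv_vb.symm, hV1_10,
        Function.update_of_ne n_ua'_vb.symm, Function.update_of_ne n_ua_vb.symm]
      exact hV1vb
  -- `Wg[ab↦1] = Wp_10[uv↦1]`
  have hWgp : Function.update Wg s(a, b) 1 = Function.update Wp_10 s(u, v) 1 := by
    rw [hWg, hV1_10, hWp_10, hWp]
    funext e
    by_cases h1 : e = s(u, a)
    · subst h1; simp [n_ab_ua.symm, n_uv_ua.symm, n_ua_ua']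
    · by_cases h2 : e = s(u, a')
      · subst h2; simp [n_ab_ua'.symm, n_uv_ua'.symm]
      · by_cases h3 : e = s(u, v)
        · subst h3; simp [n_ab_uv.symm]
        · by_cases h4 : e = s(a, b)
          · subst h4; simp [n_ab_ua, n_ab_ua', n_ab_uv]
          · simp [h1, h2, h3, h4]
  -- `u ↔ v` a.s. under `Wp_10[uv↦0]` (path u–a–b–v), so `s(u,v)` is redundant in `Wp_10`
  have hWpab : Wp s(a, b) = 1 := by rw [hWp, Function.update_self]
  have hWp10_uv : ∀ z : Fin n, R Wp_10 z = R (Function.update Wp_10 s(u, v) 1) z := by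
    intro z
    refine hred Wp_10 u v z huv ?_
    refine real_not_reachable_eq_zero_of_sure_path3 _ u a b v hua hab hvb.symm ?_ ?_ ?_
    · rw [Function.update_of_ne n_uv_ua.symm, hWp_10, Function.update_of_ne n_ua_ua', Function.update_self]
    · rw [Function.update_of_ne n_ab_uv, hWp_10, Function.update_of_ne n_ab_ua', Function.update_of_ne n_ab_ua]
      exact hWpab
    · rw [Function.update_of_ne n_bv_uv, hWp_10,
        Function.update_of_ne (png (Or.inl hub.symm) (Or.inl ha'b.symm) : (s(b, v) : Sym2 (Fin n)) ≠ s(u, a')),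
        Function.update_of_ne n_bv_ua, hWp, Function.update_of_ne n_bv_ab,
        show (s(b, v) : Sym2 (Fin n)) = s(v, b) from Sym2.eq_swap]
      exact hV1vb
  -- pendant invariance at `u` in `Wp`
  have h00p : ∀ y : Fin n, y ≠ u → Wp_00 s(u, y) = 0 := deleted_zero_at Wp haa' hua.symm hutwop
  have hWp_10' : Wp_10 = Function.update Wp_00 s(u, a) 1 := update_one_zero_eq Wp n_ua_ua'
  have hpendp : ∀ x : Fin n, x ≠ u → R Wp_10 x = R Wp_00 x := by
    intro x hxu
    show (prodBernoulli Wp_10).real _ = (prodBernoulli Wp_00).real _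
    rw [hWp_10']
    exact pendant_real_relay_eq Wp_00 A u a x j hu hua.symm hxu h00p
  have e4 : (prodBernoulli V1_10).real {ω : BondConfig (Fin n) | ω ∉ openConn c u ∧ ω ∉ openConn c v ∧
        (A.filter fun z => ω ∈ openConn c z).card ≤ j} -
      (prodBernoulli V1_10).real {ω : BondConfig (Fin n) | ω ∉ openConn c u ∧ ω ∉ openConn c v ∧
        1 ≤ (A.filter fun z => ω ∈ openConn u z ∨ ω ∈ openConn v z).card ∧
        (A.filter fun z => ω ∈ openConn u z ∨ ω ∈ openConn v z).card ≤ j} = R Wp_00 c - R Wp_00 a := by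
    rw [← g4]
    change R Wg c - _ = _
    rw [e4L, hWg_ab c, hWg_ab a, hWgp, ← hWp10_uv c, ← hWp10_uv a, hpendp c huc.symm, hpendp a hua.symm]
  -- (v): the slice "u glued to a,a', v glued to b,b'": Ψ = R Wp_11 c − R Wp_11 a
  have hV1_11uv : V1_11 s(u, v) = 0 := by
    rw [hV1_11, Function.update_of_ne n_uv_ua', Function.update_of_ne n_uv_ua]
    exact hutwo1 v huv.symm hva hva'
  have g5 := glue_pair_identity V1_11 A u v c j huv.symm hc hV1_11uv
  set Wh := Function.update V1_11 s(u, v) 1 with hWh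
  have hWh' : Wh = Function.update (Function.update (Function.update (Function.update V1 s(u, a) 0) s(u, a') 1)
      s(u, v) 1) s(u, a) 1 := by
    rw [hWh, hV1_11]
    funext e
    by_cases h1 : e = s(u, a)
    · subst h1; simp [n_uv_ua.symm, n_ua_ua']
    · by_cases h2 : e = s(u, a')
      · subst h2; simp [n_uv_ua'.symm, n_ua_ua'.symm]
      · by_cases h3 : e = s(u, v)
        · subst h3; simp [n_uv_ua]
        · simp [h1, h2, h3]
  have e5L : (prodBernoulli Wh).real {ω : BondConfig (Fin n) |
      1 ≤ (A.filter fun z => ω ∈ openConn u z).card ∧ (A.filter fun z => ω ∈ openConn u z).card ≤ j} = R Wh a := by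
    have hB : Function.update (Function.update (Function.update V1 s(u, a) 0) s(u, a') 1) s(u, v) 1 s(u, a) = 0 := by
      rw [Function.update_of_ne n_uv_ua.symm, Function.update_of_ne n_ua_ua', Function.update_self]
    have g := glued_real_count_eq _ A u a (fun m => 1 ≤ m ∧ m ≤ j) hua.symm hB
    rw [← relay_lonely_eq_small A a j ha, ← hWh'] at g
    exact g
  have hWh_ab : ∀ z : Fin n, R Wh z = R (Function.update Wh s(a, b) 1) z := by
    intro z
    refine hred Wh a b z hab ?_
    refine real_not_reachable_eq_zero_of_sure_path3 _ a u v b hua.symm huv hvb ?_ ?_ ?_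
    · rw [Function.update_of_ne n_au_ab, hWh, Function.update_of_ne n_au_uv, hV1_11,
        show (s(a, u) : Sym2 (Fin n)) = s(u, a) from Sym2.eq_swap, Function.update_of_ne n_ua_ua',
        Function.update_self]
    · rw [Function.update_of_ne n_ab_uv.symm, hWh, Function.update_self]
    · rw [Function.update_of_ne n_ab_vb.symm, hWh, Function.update_of_ne n_uv_vb.symm, hV1_11,
        Function.update_of_ne n_ua'_vb.symm, Function.update_of_ne n_ua_vb.symm]
      exact hV1vb
  have hWhp : Function.update Wh s(a, b) 1 = Function.update Wp_11 s(u, v) 1 := by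
    rw [hWh, hV1_11, hWp_11, hWp]
    funext e
    by_cases h1 : e = s(u, a)
    · subst h1; simp [n_ab_ua.symm, n_uv_ua.symm, n_ua_ua']
    · by_cases h2 : e = s(u, a')
      · subst h2; simp [n_ab_ua'.symm, n_uv_ua'.symm]
      · by_cases h3 : e = s(u, v)
        · subst h3; simp [n_ab_uv.symm]
        · by_cases h4 : e = s(a, b)
          · subst h4; simp [n_ab_ua, n_ab_ua', n_ab_uv]
          · simp [h1, h2, h3, h4]
  have hWp11_uv : ∀ z : Fin n, R Wp_11 z = R (Function.update Wp_11 s(u, v) 1) z := by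
    intro z
    refine hred Wp_11 u v z huv ?_
    refine real_not_reachable_eq_zero_of_sure_path3 _ u a b v hua hab hvb.symm ?_ ?_ ?_
    · rw [Function.update_of_ne n_uv_ua.symm, hWp_11, Function.update_of_ne n_ua_ua', Function.update_self]
    · rw [Function.update_of_ne n_ab_uv, hWp_11, Function.update_of_ne n_ab_ua', Function.update_of_ne n_ab_ua]
      exact hWpab
    · rw [Function.update_of_ne n_bv_uv, hWp_11,
        Function.update_of_ne (png (Or.inl hub.symm) (Or.inl ha'b.symm) : (s(b, v) : Sym2 (Fin n)) ≠ s(u, a')),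
        Function.update_of_ne n_bv_ua, hWp, Function.update_of_ne n_bv_ab,
        show (s(b, v) : Sym2 (Fin n)) = s(v, b) from Sym2.eq_swap]
      exact hV1vb
  have e5 : (prodBernoulli V1_11).real {ω : BondConfig (Fin n) | ω ∉ openConn c u ∧ ω ∉ openConn c v ∧
        (A.filter fun z => ω ∈ openConn c z).card ≤ j} -
      (prodBernoulli V1_11).real {ω : BondConfig (Fin n) | ω ∉ openConn c u ∧ ω ∉ openConn c v ∧
        1 ≤ (A.filter fun z => ω ∈ openConn u z ∨ ω ∈ openConn v z).card ∧
        (A.filter fun z => ω ∈ openConn u z ∨ ω ∈ openConn v z).card ≤ j} = R Wp_11 c - R Wp_11 a := by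
    rw [← g5]
    change R Wh c - _ = _
    rw [e5L, hWh_ab c, hWh_ab a, hWhp, ← hWp11_uv c, ← hWp11_uv a]
  -- assemble
  change 0 ≤ (1 - θu) * ((1 - θv) * (R V0_10 c - (prodBernoulli V0_10).real {ω : BondConfig (Fin n) |
      1 ≤ (A.filter fun z => ω ∈ openConn u z).card ∧ (A.filter fun z => ω ∈ openConn u z).card ≤ j}) + θv * _) +
    θu * ((1 - θv) * (R V0_11 c - (prodBernoulli V0_11).real {ω : BondConfig (Fin n) |
      1 ≤ (A.filter fun z => ω ∈ openConn u z).card ∧ (A.filter fun z => ω ∈ openConn u z).card ≤ j}) + θv * _)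
  rw [e1, e2, e3, e4, e5]
  linarith

end TwoPortPeeling

end Summit.CriticalPhenomena.PercolationContinuityZ3.Theorems

end
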